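import Mathlib
import HarnessLib
import Summits.BirchSwinnertonDyer.BirchSwinnertonDyer.Theorems.SylvesterTwoHeegnerIndexUnramifiedQuadraticHilbert90

/-!
# Route `SylvesterTwoHeegnerIndex` (rung K7t): the `ℤ₂[ω]`-linear algebra of ROAD (k), PART V —
# CHARACTERS: `ℤ/2^M`-valued characters separate points; DESCENT OF CHARACTERS through LEMMA D
# (`S* = Hom(S^τ, ℤ/2^M)`, memo §64.2 (C4)/(C5)); two proper subgroups; `#(𝒪/2^N-line) = 4^N`

Cell `bsd-cm`, seat `bsd-cm-k7t-c2` (prover-bsd-cm-k7t-c2-g16-0; hand item 19229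
`HeegnerIndexUpperAtTwoHSY`: verdict unchanged, NOT FOUND as a theorem — fact-free, equivalent modulo
the route's facts to `MissingUpperBoundAt B 2`, open as a class). PARTITION (D-0054): CornerF at `p = 2`
(B14/O12) × 𝒞_HSY (`E_p : x³ + y³ = p`) × `p = 2` — types-the-object-of: the ČEBOTAREV BOOKKEEPING of
the `𝒪`-linear Kolyvagin argument over `K = ℚ(ω)` at the inert prime `2` (ROAD (k); line card
`Cruxes/UpperOffV0HSYPlus/Lines/cmframe-kolyvagin2.md`, skeleton of record VARIANT J
`Cruxes/UpperOffV0HSYPlus/Lines/coupled_variantJ.lean`, stub (K3-4) = THEOREM K3 typed), continuing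
Parts I–IV (`…UnramifiedQuadraticDescent` p553247 = LEMMA D, `…Pairings` p571041, `…Orders` p576537,
`…Hilbert90` p578952). Kernel helper `--supports stmt-BirchSwinnertonDyer-19804 --as helper` (planner
GO STATUS l.1738); closes no cell and no item; moves no label; BSD is not claimed; THEOREM K3 stays a
PAPER theorem (memo two = `HOME/MEMO-bsd-cm-two.md` v2.20 §64–§66, refereed g61) — nothing below is an
Euler-system statement. Everything is PROVED abstract algebra over Mathlib in the (M, w, σ)-encoding
of Parts I–IV: no definition, no named fact, no instance, no notation, no `sorry`.

SETTING (as in Parts I–IV): `M` an additive group with `w : M →+ M`, `w² + w + 1 = 0` and a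
conjugation-semilinear involution `σ` (`σ² = id`, `σ w = w̄ σ`, `w̄ = −1 − w`); `M^σ` is realised as the
kernel of `σ − id`; `3` acts bijectively (any `2`-primary group, Part I). A second such datum
`(Q, w_Q, σ_Q)` is the TARGET («`𝒪/2^M` with complex conjugation»: a cyclic `𝒪/2^N`-line — generator
`e`, `2^N e = 0`, `2^k e = 0 → N ≤ k` — with a `σ_Q`-INVARIANT generator, which exists by Part IV
`exists_invariant_generator`; then `Q^σ = ℤ·e`, Part IV `sigma_eq_self_iff_exists_zsmul`). A functional
`φ : M →+ Q` is `𝒪`-LINEAR if `φ ∘ w = w_Q ∘ φ` and `τ`-EQUIVARIANT if `φ ∘ σ = σ_Q ∘ φ`.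

WHAT IS PROVED, AND WHERE ROAD (k) USES IT ([McC91] = W. G. McCallum, *Kolyvagin's work on
Shafarevich–Tate groups*, LMS LN 153 (1991), §3 and Prop. 5.2; memo §64.2, §64.4).
* §A `ℤ/n`-VALUED CHARACTERS SEPARATE POINTS of an `n`-torsion abelian group
  (`exists_addMonoidHom_zmod_apply_ne_zero`; from Mathlib's `ℚ/ℤ`-cogenerator
  `CharacterModule.exists_character_apply_ne_zero_of_ne_zero` and the RESIDUE MAP `θ(y) = r(y)/n` of an
  `n`-torsion `ℚ/ℤ`-character, `exists_residue`) — the duality implicit under memo (C5).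
* §B DESCENT OF CHARACTERS (memo (C4) «`S = S^τ ⊗ O`, `S* := H^τ = Hom(S^τ, ℤ/2^M)`», (C5)): every
  additive `α : M^σ → Q` EXTENDS to `φ_α` with `φ_α(s + ωt) = α s + ω α t` (`exists_extension`, LEMMA D
  onto); an extension is `𝒪`-LINEAR (`map_w_of_extension`) and, for `Q^σ`-valued `α`, `τ`-EQUIVARIANT
  (`map_sigma_of_extension`); conversely a `τ`-equivariant `𝒪`-linear `φ` maps `M^σ` into `Q^σ` and
  is the extension of its restriction (`sigma_apply_of_equivariant`, `apply_descent_of_olinear`); and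
  «`1, ω` independent over `ℤ/2^M`»: `φ_α(s + ωt) = 0 ↔ α s = α t = 0` (`apply_eq_zero_iff_of_extension`,
  LEMMA D one-to-one on the target). CONSEQUENCE = (C5) PROPER (`exists_equivariant_apply_ne_zero`,
  `…_of_line`): on `M` killed by `2^N` the `τ`-equivariant `𝒪`-linear functionals into a cyclic
  `𝒪/2^N`-line with invariant generator SEPARATE POINTS — for `s ≠ 0` the annihilator
  `{φ ∈ S* : φ(s) = 0}` is a PROPER subgroup [McC91 p. 280 Prop 3.1, p. 286; memo Prop 3.1′/5.2′: `ψ`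
  is chosen off the annihilator of `c_{M_r+1}(n)` and off `X + 2C*`].
* §C «A GROUP IS NOT THE UNION OF TWO PROPER SUBGROUPS» (`exists_not_mem_of_ne_top`) — the sentence
  [McC91 p. 286] uses for that double avoidance (memo §64.4: «unchanged»; finiteness not needed).
* §D `#(cyclic 𝒪/2^N-line) = 4^N` (`card_line_eq`, from Part III's freeness): the count behind memo
  §64.1 (P7)'s Greenberg–Wiles quotient `#H¹(K_{λ₀}, X[2]) / #δ(X(K_{λ₀})) = 16/4` and §65.2 (i).
NOT here: the triangular-system / dual-basis count of memo §64.5 (PART VI, separate file).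
-/

set_option autoImplicit false
set_option linter.dupNamespace false

namespace Summit.BirchSwinnertonDyer.BirchSwinnertonDyer.Theorems.SylvesterTwoUnramifiedCharacters

open Summit.BirchSwinnertonDyer.BirchSwinnertonDyer.Theorems.SylvesterTwoUnramifiedDescent
open Summit.BirchSwinnertonDyer.BirchSwinnertonDyer.Theorems.SylvesterTwoUnramifiedPairings
open Summit.BirchSwinnertonDyer.BirchSwinnertonDyer.Theorems.SylvesterTwoUnramifiedOrders
open Summit.BirchSwinnertonDyer.BirchSwinnertonDyer.Theorems.SylvesterTwoUnramifiedHilbert90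

/-! ### §A `ℤ/n`-valued characters separate points of an `n`-torsion abelian group -/

section Characters

variable {G : Type*} [AddCommGroup G]

/-- An element of `ℚ/ℤ` killed by `n ≠ 0` is the class of `a / n`, `a ∈ ℤ`. [Brown III (4.3)] -/
theorem exists_eq_coe_int_div_of_nsmul_eq_zero {n : ℕ} (hn : n ≠ 0) {u : AddCircle (1 : ℚ)}
    (hu : n • u = 0) : ∃ a : ℤ, u = (((a : ℚ) / (n : ℚ) : ℚ) : AddCircle (1 : ℚ)) := by
  induction u using QuotientAddGroup.induction_on with
  | H q =>
    change n • ((q : ℚ) : AddCircle (1 : ℚ)) = 0 at hu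
    rw [← AddCircle.coe_nsmul, AddCircle.coe_eq_zero_iff] at hu
    obtain ⟨a, ha⟩ := hu
    refine ⟨a, ?_⟩
    change ((q : ℚ) : AddCircle (1 : ℚ)) = _
    congr 1
    have hn' : (n : ℚ) ≠ 0 := Nat.cast_ne_zero.mpr hn
    rw [eq_div_iff hn']
    rw [zsmul_eq_mul, mul_one, nsmul_eq_mul] at ha
    rw [ha, mul_comm]

/-- Two classes `a / n`, `b / n` agree in `ℚ/ℤ` iff `a ≡ b (mod n)`. [folklore] -/
theorem coe_int_div_eq_coe_int_div_iff {n : ℕ} (hn : n ≠ 0) {a b : ℤ} :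
    ((((a : ℚ) / (n : ℚ) : ℚ)) : AddCircle (1 : ℚ)) = (((b : ℚ) / (n : ℚ) : ℚ)) ↔
      (a : ZMod n) = (b : ZMod n) := by
  have hn' : (n : ℚ) ≠ 0 := Nat.cast_ne_zero.mpr hn
  rw [← sub_eq_zero, ← AddCircle.coe_sub, ← sub_div, AddCircle.coe_eq_zero_iff,
    ZMod.intCast_eq_intCast_iff_dvd_sub a b n]
  constructor
  · rintro ⟨c, hc⟩
    rw [zsmul_eq_mul, mul_one, eq_div_iff hn'] at hc
    refine ⟨-c, ?_⟩
    have h : ((c * (n : ℤ) : ℤ) : ℚ) = ((a - b : ℤ) : ℚ) := by push_cast; linarith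
    have h' := (Int.cast_inj (α := ℚ)).mp h
    linarith
  · rintro ⟨c, hc⟩
    refine ⟨-c, ?_⟩
    rw [zsmul_eq_mul, mul_one, eq_div_iff hn', Int.cast_neg]
    have h : ((b - a : ℤ) : ℚ) = (((n : ℤ) * c : ℤ) : ℚ) := by rw [hc]
    push_cast at h
    linarith

/-- **RESIDUE MAP.** A character `θ : G → ℚ/ℤ` killed by `n ≠ 0` has an additive «residue map»
`r : G → ℤ/n` with `θ(y) = r(y)/n` (`r` is unique: the right-hand side determines `r y`). [folklore] -/
theorem exists_residue {n : ℕ} (hn : n ≠ 0) (θ : G →+ AddCircle (1 : ℚ)) (hθ : ∀ y, n • θ y = 0) :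
    ∃ r : G →+ ZMod n, ∀ (y : G) (a : ℤ),
      θ y = (((a : ℚ) / (n : ℚ) : ℚ) : AddCircle (1 : ℚ)) ↔ r y = (a : ZMod n) := by
  have hex : ∀ y : G, ∃ a : ℤ, θ y = (((a : ℚ) / (n : ℚ) : ℚ) : AddCircle (1 : ℚ)) := fun y =>
    exists_eq_coe_int_div_of_nsmul_eq_zero hn (hθ y)
  choose a ha using hex
  have hchar : ∀ (y : G) (b : ℤ),
      θ y = (((b : ℚ) / (n : ℚ) : ℚ) : AddCircle (1 : ℚ)) ↔ (a y : ZMod n) = b := by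
    intro y b; rw [ha y]; exact coe_int_div_eq_coe_int_div_iff hn
  refine ⟨{ toFun := fun y => (a y : ZMod n), map_zero' := ?_, map_add' := fun y y' => ?_ },
    fun y b => hchar y b⟩
  · simpa using (hchar 0 0).mp (by rw [map_zero]; simp)
  · have h : θ (y + y') = ((((a y + a y' : ℤ) : ℚ) / (n : ℚ) : ℚ) : AddCircle (1 : ℚ)) := by
      rw [map_add, ha y, ha y', ← AddCircle.coe_add, ← add_div, Int.cast_add]
    have h' := (hchar (y + y') (a y + a y')).mp h
    rw [Int.cast_add] at h'
    exact h'

/-- **`ℤ/n`-VALUED CHARACTERS SEPARATE POINTS OF AN `n`-TORSION ABELIAN GROUP** (`n ≠ 0`; no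
finiteness needed): for `x ≠ 0` there is `φ : G →+ ℤ/n` with `φ x ≠ 0`. Proof: a `ℚ/ℤ`-character
not vanishing at `x` (Mathlib's cogenerator) is killed by `n`, and its residue map does it.
[memo §64.2 (C5): the duality `Hom(S^τ, ℤ/2^M)` separates the points of `S^τ`, implicit there.] -/
theorem exists_addMonoidHom_zmod_apply_ne_zero {n : ℕ} (hn : n ≠ 0) (hG : ∀ x : G, n • x = 0)
    {x : G} (hx : x ≠ 0) : ∃ φ : G →+ ZMod n, φ x ≠ 0 := by
  obtain ⟨c, hc⟩ := CharacterModule.exists_character_apply_ne_zero_of_ne_zero hx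
  have hθ : ∀ y, n • (show G →+ AddCircle (1 : ℚ) from c) y = 0 := fun y => by
    change n • c y = 0
    rw [← map_nsmul, hG, map_zero]
  obtain ⟨r, hr⟩ := exists_residue hn (show G →+ AddCircle (1 : ℚ) from c) hθ
  refine ⟨r, fun h0 => hc ?_⟩
  change (show G →+ AddCircle (1 : ℚ) from c) x = 0
  rw [(hr x 0).mpr (by rw [h0, Int.cast_zero]), Int.cast_zero, zero_div, AddCircle.coe_zero]

/-! ### §C A group is not the union of two proper subgroups -/

/-- **A GROUP IS NOT THE UNION OF TWO PROPER SUBGROUPS**: if `H₁, H₂ ≠ ⊤` some element avoids both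
(`a ∉ H₁`, `b ∉ H₂`; if `a ∈ H₂`, `b ∈ H₁` take `a + b`). [McC91 p. 286 «since a finite group is not a
union of two proper subgroups» (finiteness not needed); memo §64.4 Prop 5.2′: `ψ ∉ X + 2C*`, `ψ ∉ ⟨c⟩^⊥`.] -/
theorem exists_not_mem_of_ne_top {H₁ H₂ : AddSubgroup G} (h₁ : H₁ ≠ ⊤) (h₂ : H₂ ≠ ⊤) :
    ∃ x : G, x ∉ H₁ ∧ x ∉ H₂ := by
  obtain ⟨a, ha⟩ : ∃ a, a ∉ H₁ := not_forall.mp ((AddSubgroup.eq_top_iff' H₁).not.mp h₁)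
  obtain ⟨b, hb⟩ : ∃ b, b ∉ H₂ := not_forall.mp ((AddSubgroup.eq_top_iff' H₂).not.mp h₂)
  by_cases ha₂ : a ∈ H₂
  · by_cases hb₁ : b ∈ H₁
    · exact ⟨a + b, fun h => ha (by simpa using H₁.sub_mem h hb₁),
        fun h => hb (by simpa using H₂.sub_mem h ha₂)⟩
    · exact ⟨b, hb₁, hb⟩
  · exact ⟨a, ha, ha₂⟩

end Characters

/-! ### §B Descent of characters through LEMMA D -/

section Descent

variable {M : Type*} [AddCommGroup M] {Q : Type*} [AddCommGroup Q]

/-- **EXTENSION.** Every additive `α : M^σ → Q` extends to a functional `φ : M →+ Q` with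
`φ (s + ω t) = α s + ω_Q α t` for all `s, t ∈ M^σ` — well defined because `(s, t) ↦ s + ω t` is a
bijection `M^σ × M^σ → M` (LEMMA D, Part I `descent_bijective`). [memo §64.2 (C4): an element of
`Hom(S^τ, ℤ/2^M)` read as an `O`-linear functional on `S = S^τ ⊗ O`.] -/
theorem exists_extension (w σ : M →+ M) (hw : ∀ x, w (w x) + w x + x = 0)
    (hσ : ∀ x, σ (σ x) = x) (hσw : ∀ x, σ (w x) = -(σ x) - w (σ x))
    (h3 : Function.Bijective fun x : M => (3 : ℤ) • x) (wQ : Q →+ Q)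
    (α : (σ - AddMonoidHom.id M).ker →+ Q) :
    ∃ φ : M →+ Q, ∀ s t : (σ - AddMonoidHom.id M).ker, φ ((s : M) + w t) = α s + wQ (α t) := by
  -- the descent map `(s, t) ↦ s + ω t` as a bundled homomorphism; bijective by LEMMA D
  let D : (σ - AddMonoidHom.id M).ker × (σ - AddMonoidHom.id M).ker →+ M :=
    (σ - AddMonoidHom.id M).ker.subtype.coprod (w.comp (σ - AddMonoidHom.id M).ker.subtype)
  have hD : ⇑D = fun st : (σ - AddMonoidHom.id M).ker × (σ - AddMonoidHom.id M).ker =>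
      (st.1 : M) + w st.2 := funext fun st => by simp [D, AddMonoidHom.coprod_apply]
  have hbij : Function.Bijective D := by rw [hD]; exact descent_bijective w σ hw hσ hσw h3
  let E := AddEquiv.ofBijective D hbij
  refine ⟨(α.coprod (wQ.comp α)).comp (E.symm : M →+ _), fun s t => ?_⟩
  have hE : E (s, t) = (s : M) + w t := congrFun hD (s, t)
  rw [← hE, AddMonoidHom.comp_apply]
  change (α.coprod (wQ.comp α)) (E.symm (E (s, t))) = _
  rw [AddEquiv.symm_apply_apply, AddMonoidHom.coprod_apply, AddMonoidHom.comp_apply]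

/-- `ω (s + ω t) = (−t) + ω (s − t)`: `ω` in descended coordinates. -/
theorem w_apply_descent (w : M →+ M) (hw : ∀ x, w (w x) + w x + x = 0) (s t : M) :
    w (s + w t) = -t + w (s - t) := by
  have e : w (w t) = -(w t) - t := by
    rw [← sub_eq_zero]; rw [← hw t]; abel
  rw [map_add, e, map_sub]; abel

/-- `σ (s + ω t) = (s − t) + ω (−t)` for `σ`-invariant `s, t`: `σ` in descended coordinates. -/
theorem sigma_apply_descent (w σ : M →+ M) (hσw : ∀ x, σ (w x) = -(σ x) - w (σ x)) {s t : M}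
    (hs : σ s = s) (ht : σ t = t) : σ (s + w t) = (s - t) + w (-t) := by
  rw [map_add, hσw, hs, ht, map_neg]; abel

/-- **AN EXTENSION IS `𝒪`-LINEAR**: if `φ (s + ω t) = α s + ω_Q α t` on descended coordinates, then
`φ ∘ ω = ω_Q ∘ φ` on all of `M`. -/
theorem map_w_of_extension (w σ : M →+ M) (hw : ∀ x, w (w x) + w x + x = 0)
    (hσ : ∀ x, σ (σ x) = x) (hσw : ∀ x, σ (w x) = -(σ x) - w (σ x))
    (h3 : Function.Bijective fun x : M => (3 : ℤ) • x) (wQ : Q →+ Q)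
    (hwQ : ∀ q, wQ (wQ q) + wQ q + q = 0) {α : (σ - AddMonoidHom.id M).ker →+ Q} {φ : M →+ Q}
    (hφ : ∀ s t : (σ - AddMonoidHom.id M).ker, φ ((s : M) + w t) = α s + wQ (α t)) (x : M) :
    φ (w x) = wQ (φ x) := by
  obtain ⟨⟨s, t⟩, hst⟩ := descent_surjective w σ hw hσ hσw h3 x
  simp only at hst
  rw [← hst, w_apply_descent w hw]
  have h1 : -(t : M) + w ((s : M) - t) = ((-t : (σ - AddMonoidHom.id M).ker) : M) +
      w ((s - t : (σ - AddMonoidHom.id M).ker) : M) := by simp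
  rw [h1, hφ, hφ, map_neg, map_sub, map_add, map_sub]
  have e : wQ (wQ (α t)) = -(wQ (α t)) - α t := by
    rw [← sub_eq_zero]; rw [← hwQ (α t)]; abel
  rw [e]; abel

/-- **AN EXTENSION OF A `Q^σ`-VALUED MAP IS `τ`-EQUIVARIANT**: if moreover `σ_Q (α s) = α s` for all
`s`, then `φ ∘ σ = σ_Q ∘ φ`. [memo §64.2 (C4): `S* = Hom(S^τ, ℤ/2^M) ⊗ 1 = H^τ`, the `τ`-FIXED
characters.] -/
theorem map_sigma_of_extension (w σ : M →+ M) (hw : ∀ x, w (w x) + w x + x = 0)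
    (hσ : ∀ x, σ (σ x) = x) (hσw : ∀ x, σ (w x) = -(σ x) - w (σ x))
    (h3 : Function.Bijective fun x : M => (3 : ℤ) • x) (wQ σQ : Q →+ Q)
    (hσwQ : ∀ q, σQ (wQ q) = -(σQ q) - wQ (σQ q)) {α : (σ - AddMonoidHom.id M).ker →+ Q}
    (hα : ∀ s, σQ (α s) = α s) {φ : M →+ Q}
    (hφ : ∀ s t : (σ - AddMonoidHom.id M).ker, φ ((s : M) + w t) = α s + wQ (α t)) (x : M) :
    φ (σ x) = σQ (φ x) := by
  obtain ⟨⟨s, t⟩, hst⟩ := descent_surjective w σ hw hσ hσw h3 x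
  simp only at hst
  have hs := (mem_ker_sub_id_iff σ _).mp s.2
  have ht := (mem_ker_sub_id_iff σ _).mp t.2
  rw [← hst, sigma_apply_descent w σ hσw hs ht]
  have h1 : ((s : M) - t) + w (-(t : M)) = ((s - t : (σ - AddMonoidHom.id M).ker) : M) +
      w ((-t : (σ - AddMonoidHom.id M).ker) : M) := by simp
  rw [h1, hφ, hφ, map_sub, map_neg, map_add, hσwQ, hα, hα, map_neg]
  abel

/-- **«`1, ω` ARE INDEPENDENT OVER `ℤ/2^M`»** (memo §64.2 (C5)): for an extension `φ` of a `Q^σ`-valued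
`α`, `φ (s + ω t) = 0 ↔ α s = 0 ∧ α t = 0` — by LEMMA D's injectivity on the TARGET (`α s + ω_Q α t = 0`
with `α s, α t ∈ Q^σ` forces both to vanish). -/
theorem apply_eq_zero_iff_of_extension (w : M →+ M) (σ : M →+ M) (wQ σQ : Q →+ Q)
    (hwQ : ∀ q, wQ (wQ q) + wQ q + q = 0) (hσwQ : ∀ q, σQ (wQ q) = -(σQ q) - wQ (σQ q))
    (h3Q : Function.Bijective fun q : Q => (3 : ℤ) • q) {α : (σ - AddMonoidHom.id M).ker →+ Q}
    (hα : ∀ s, σQ (α s) = α s) {φ : M →+ Q}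
    (hφ : ∀ s t : (σ - AddMonoidHom.id M).ker, φ ((s : M) + w t) = α s + wQ (α t))
    (s t : (σ - AddMonoidHom.id M).ker) : φ ((s : M) + w t) = 0 ↔ α s = 0 ∧ α t = 0 := by
  rw [hφ]
  constructor
  · intro h
    have hs' : α s ∈ (σQ - AddMonoidHom.id Q).ker := (mem_ker_sub_id_iff σQ _).mpr (hα s)
    have ht' : α t ∈ (σQ - AddMonoidHom.id Q).ker := (mem_ker_sub_id_iff σQ _).mpr (hα t)
    have h1 : ((⟨α s, hs'⟩, ⟨α t, ht'⟩) :
        (σQ - AddMonoidHom.id Q).ker × (σQ - AddMonoidHom.id Q).ker) = (0, 0) :=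
      descent_injective wQ σQ hwQ hσwQ h3Q (by simpa using h)
    simp only [Prod.mk.injEq, Subtype.ext_iff, AddSubgroup.coe_zero] at h1
    exact h1
  · rintro ⟨hs, ht⟩
    rw [hs, ht, map_zero, add_zero]

/-- **CONVERSELY, EVERY `𝒪`-LINEAR `τ`-EQUIVARIANT FUNCTIONAL MAPS `M^σ` INTO `Q^σ`** … -/
theorem sigma_apply_of_equivariant (σ : M →+ M) (σQ : Q →+ Q) {φ : M →+ Q}
    (hφσ : ∀ x, φ (σ x) = σQ (φ x)) (s : (σ - AddMonoidHom.id M).ker) : σQ (φ s) = φ s := by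
  rw [← hφσ, (mem_ker_sub_id_iff σ _).mp s.2]

/-- … **AND IS THE EXTENSION OF ITS RESTRICTION**: `φ (s + ω t) = φ s + ω_Q φ t` (so, with
`exists_extension`, the `τ`-equivariant `𝒪`-linear functionals `M → Q` are EXACTLY the extensions of
the additive maps `M^σ → Q^σ`: «`S* ⊗ 𝒪 = Hom_𝒪(S, Q)` descends to `S* = Hom(S^τ, Q^σ)`»). -/
theorem apply_descent_of_olinear (w : M →+ M) (wQ : Q →+ Q) {φ : M →+ Q}
    (hφw : ∀ x, φ (w x) = wQ (φ x)) (s t : M) : φ (s + w t) = φ s + wQ (φ t) := by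
  rw [map_add, hφw]

/-- **(C5) PROPER — THE `τ`-EQUIVARIANT `𝒪`-LINEAR FUNCTIONALS SEPARATE POINTS**: if the additive maps
`M^σ → Q` with values in `Q^σ` separate the points of `M^σ`, then for every `x ≠ 0` in `M` there is an
`𝒪`-linear, `τ`-equivariant `φ : M →+ Q` with `φ x ≠ 0`; equivalently the annihilator
`{φ ∈ S* : φ x = 0}` is a PROPER subgroup of `S*`. (`x = s + ω t` with `(s, t) ≠ (0, 0)`; an `α` not
vanishing at the non-zero coordinate extends to `φ_α`, and `φ_α x = 0` would force `α s = α t = 0`.)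
[memo §64.2 (C5); McC91 p. 280 / p. 286.] -/
theorem exists_equivariant_apply_ne_zero (w σ : M →+ M) (hw : ∀ x, w (w x) + w x + x = 0)
    (hσ : ∀ x, σ (σ x) = x) (hσw : ∀ x, σ (w x) = -(σ x) - w (σ x))
    (h3 : Function.Bijective fun x : M => (3 : ℤ) • x) (wQ σQ : Q →+ Q)
    (hwQ : ∀ q, wQ (wQ q) + wQ q + q = 0) (hσwQ : ∀ q, σQ (wQ q) = -(σQ q) - wQ (σQ q))
    (h3Q : Function.Bijective fun q : Q => (3 : ℤ) • q)
    (hsep : ∀ s : (σ - AddMonoidHom.id M).ker, s ≠ 0 →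
      ∃ α : (σ - AddMonoidHom.id M).ker →+ Q, (∀ s', σQ (α s') = α s') ∧ α s ≠ 0)
    {x : M} (hx : x ≠ 0) :
    ∃ φ : M →+ Q, (∀ y, φ (w y) = wQ (φ y)) ∧ (∀ y, φ (σ y) = σQ (φ y)) ∧ φ x ≠ 0 := by
  obtain ⟨⟨s, t⟩, hst⟩ := descent_surjective w σ hw hσ hσw h3 x
  simp only at hst
  -- a non-zero descended coordinate `u ∈ {s, t}` of `x`
  obtain ⟨u, hu, hux⟩ : ∃ u : (σ - AddMonoidHom.id M).ker, u ≠ 0 ∧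
      ∀ α : (σ - AddMonoidHom.id M).ker →+ Q, α s = 0 ∧ α t = 0 → α u = 0 := by
    by_cases hs : s = 0
    · refine ⟨t, fun ht => hx ?_, fun α h => h.2⟩
      rw [← hst, hs, ht]; simp
    · exact ⟨s, hs, fun α h => h.1⟩
  -- a `Q^σ`-valued `α` not vanishing at `u`, extended to `M`
  obtain ⟨α, hα, hαu⟩ := hsep u hu
  obtain ⟨φ, hφ⟩ := exists_extension w σ hw hσ hσw h3 wQ α
  refine ⟨φ, map_w_of_extension w σ hw hσ hσw h3 wQ hwQ hφ,
    map_sigma_of_extension w σ hw hσ hσw h3 wQ σQ hσwQ hα hφ, fun h0 => hαu (hux α ?_)⟩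
  rwa [← hst, apply_eq_zero_iff_of_extension w σ wQ σQ hwQ hσwQ h3Q hα hφ] at h0

/-- **(C5) ON A CYCLIC `𝒪/2^N`-LINE TARGET** (the memo's `𝒪/2^M` with complex conjugation): if `M` is
killed by `2^N` and `Q` is a cyclic `𝒪/2^N`-line with a `σ_Q`-INVARIANT generator `e` (Part IV
`exists_invariant_generator`; `Q^σ = ℤ·e ≅ ℤ/2^N` by Part IV `sigma_eq_self_iff_exists_zsmul`), then
the `τ`-equivariant `𝒪`-linear functionals `M → Q` SEPARATE THE POINTS of `M`. The separating maps
`M^σ → Q^σ` are `s ↦ χ(s)·e` for the `ℤ/2^N`-valued characters `χ` of §A, `k ↦ k·e` being injective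
on `ℤ/2^N` by Part III's freeness `smul_add_smul_w_eq_zero_iff`. [memo §64.2 (C5) in full.] -/
theorem exists_equivariant_apply_ne_zero_of_line (w σ : M →+ M) (hw : ∀ x, w (w x) + w x + x = 0)
    (hσ : ∀ x, σ (σ x) = x) (hσw : ∀ x, σ (w x) = -(σ x) - w (σ x))
    (h3 : Function.Bijective fun x : M => (3 : ℤ) • x) {N : ℕ}
    (hM : ∀ x : M, (2 : ℤ) ^ N • x = 0) (wQ σQ : Q →+ Q)
    (hwQ : ∀ q, wQ (wQ q) + wQ q + q = 0) (hσwQ : ∀ q, σQ (wQ q) = -(σQ q) - wQ (σQ q))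
    (h3Q : Function.Bijective fun q : Q => (3 : ℤ) • q) {e : Q}
    (he : ∀ q : Q, ∃ m n : ℤ, q = m • e + n • wQ e) (hN : (2 : ℤ) ^ N • e = 0)
    (hmin : ∀ k : ℕ, (2 : ℤ) ^ k • e = 0 → N ≤ k) (hσe : σQ e = e) {x : M} (hx : x ≠ 0) :
    ∃ φ : M →+ Q, (∀ y, φ (w y) = wQ (φ y)) ∧ (∀ y, φ (σ y) = σQ (φ y)) ∧ φ x ≠ 0 := by
  apply exists_equivariant_apply_ne_zero w σ hw hσ hσw h3 wQ σQ hwQ hσwQ h3Q _ hx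
  intro s hs
  have h2N : ((2 ^ N : ℕ) : ℤ) = (2 : ℤ) ^ N := by push_cast; ring
  have hn : (2 ^ N : ℕ) ≠ 0 := pow_ne_zero _ two_ne_zero
  -- `M^σ` is killed by `2^N`
  have hS : ∀ y : (σ - AddMonoidHom.id M).ker, (2 ^ N : ℕ) • y = 0 := by
    intro y
    apply Subtype.ext
    rw [AddSubgroupClass.coe_nsmul, AddSubgroup.coe_zero, ← natCast_zsmul, h2N]
    exact hM y
  -- a `ℤ/2^N`-valued character not vanishing at `s`
  obtain ⟨χ, hχ⟩ := exists_addMonoidHom_zmod_apply_ne_zero hn hS hs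
  -- the embedding `ℤ/2^N ↪ Q`, `k ↦ k·e`
  have hkill : (zmultiplesHom Q e) ((2 ^ N : ℕ) : ℤ) = 0 := by
    rw [zmultiplesHom_apply, h2N]; exact hN
  let ι : ZMod (2 ^ N) →+ Q := ZMod.lift (2 ^ N) ⟨zmultiplesHom Q e, hkill⟩
  have hι : ∀ k : ℤ, ι (k : ZMod (2 ^ N)) = k • e := fun k => by
    change ZMod.lift (2 ^ N) ⟨zmultiplesHom Q e, hkill⟩ (k : ZMod (2 ^ N)) = k • e
    rw [ZMod.lift_coe]; rfl
  have hιinj : Function.Injective ι := by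
    rw [ZMod.lift_injective]
    intro m hm
    change m • e = 0 at hm
    have h0 : m • e + (0 : ℤ) • wQ e = 0 := by rw [hm, zero_smul, add_zero]
    have hdvd := ((smul_add_smul_w_eq_zero_iff wQ hwQ he hN hmin m 0).mp h0).1
    rw [ZMod.intCast_zmod_eq_zero_iff_dvd, h2N]
    exact hdvd
  refine ⟨ι.comp χ, fun s' => ?_, fun h0 => hχ (hιinj ?_)⟩
  · obtain ⟨k, hk⟩ := ZMod.intCast_surjective (χ s')
    rw [AddMonoidHom.comp_apply, ← hk, hι, map_zsmul, hσe]
  · rw [AddMonoidHom.comp_apply] at h0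
    rw [h0, map_zero]

end Descent

/-! ### §D The cardinality of a cyclic `𝒪/2^N`-line -/

section Card

variable {M : Type*} [AddCommGroup M]

/-- **`#(CYCLIC 𝒪/2^N-LINE) = 4^N`**: `(a, b) ↦ a e + b ωe` is a bijection `ℤ/2^N × ℤ/2^N → M`
(onto because `e` generates, one-to-one by Part III's freeness `smul_add_smul_w_eq_zero_iff`).
[memo §64.1 (P7): `#H¹(K_{λ₀}, X[2]) / #δ(X(K_{λ₀})) = 16/4 = 4` — two `𝒪/2`-lines against one;
§65.2 (i): `#(O/2^{2N})² / #(O/2^{2N}) = 4^{2N}`.] -/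
theorem card_line_eq (w : M →+ M) (hw : ∀ x, w (w x) + w x + x = 0) {N : ℕ} {e : M}
    (he : ∀ x : M, ∃ m n : ℤ, x = m • e + n • w e) (hN : (2 : ℤ) ^ N • e = 0)
    (hmin : ∀ k : ℕ, (2 : ℤ) ^ k • e = 0 → N ≤ k) : Nat.card M = 4 ^ N := by
  have h2N : ((2 ^ N : ℕ) : ℤ) = (2 : ℤ) ^ N := by push_cast; ring
  have hkill₁ : (zmultiplesHom M e) ((2 ^ N : ℕ) : ℤ) = 0 := by
    rw [zmultiplesHom_apply, h2N]; exact hN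
  have hkill₂ : (zmultiplesHom M (w e)) ((2 ^ N : ℕ) : ℤ) = 0 := by
    rw [zmultiplesHom_apply, h2N, ← map_zsmul, hN, map_zero]
  let f₁ : ZMod (2 ^ N) →+ M := ZMod.lift (2 ^ N) ⟨zmultiplesHom M e, hkill₁⟩
  let f₂ : ZMod (2 ^ N) →+ M := ZMod.lift (2 ^ N) ⟨zmultiplesHom M (w e), hkill₂⟩
  let f : ZMod (2 ^ N) × ZMod (2 ^ N) →+ M := f₁.coprod f₂
  have hf : ∀ m n : ℤ, f ((m : ZMod (2 ^ N)), (n : ZMod (2 ^ N))) = m • e + n • w e := by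
    intro m n
    change ZMod.lift (2 ^ N) ⟨zmultiplesHom M e, hkill₁⟩ (m : ZMod (2 ^ N)) +
      ZMod.lift (2 ^ N) ⟨zmultiplesHom M (w e), hkill₂⟩ (n : ZMod (2 ^ N)) = _
    rw [ZMod.lift_coe, ZMod.lift_coe]; rfl
  have hbij : Function.Bijective f := by
    constructor
    · rw [injective_iff_map_eq_zero]
      rintro ⟨a, b⟩ hab
      obtain ⟨m, rfl⟩ := ZMod.intCast_surjective a
      obtain ⟨n, rfl⟩ := ZMod.intCast_surjective b
      rw [hf] at hab
      obtain ⟨hm, hn⟩ := (smul_add_smul_w_eq_zero_iff w hw he hN hmin m n).mp hab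
      rw [Prod.mk_eq_zero, ZMod.intCast_zmod_eq_zero_iff_dvd, ZMod.intCast_zmod_eq_zero_iff_dvd, h2N]
      exact ⟨hm, hn⟩
    · intro x
      obtain ⟨m, n, rfl⟩ := he x
      exact ⟨((m : ZMod (2 ^ N)), (n : ZMod (2 ^ N))), hf m n⟩
  rw [← Nat.card_congr (Equiv.ofBijective f hbij), Nat.card_prod, Nat.card_zmod, ← mul_pow]
  norm_num

end Card

end Summit.BirchSwinnertonDyer.BirchSwinnertonDyer.Theorems.SylvesterTwoUnramifiedCharacters
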